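import Mathlib
import HarnessLib
import Literature.Analysis.Calculus.SphereSpectralShell
import Summits.Ventures.LatticeQCDFlow.Exactness.SphereTangentialLaplacian

/-!
# Green's identity for Engel–Schaefer's natural operators on one site sphere: `∫ g·∂̃∂̃f dσ = −∫ ⟪∂̃g, ∂̃f⟫ dσ`

HONEST FRAMING: exact (Metropolis-corrected) sampling algorithms for lattice gauge theory;
figures of merit are autocorrelation/cost numbers at stated couplings and volumes; no
continuum-physics claim.

Venture `LatticeQCDFlow` (cell pub-lqcd), topic `Exactness`; FANOUT row 7 (`s0-cpn-null`: the
S0-D1 rung — 2D CP⁹, Lüscher's LO trivializing map inside HMC, Engel–Schaefer 2011).  NEW WORK of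
the cell over Mathlib, the tree's `Exactness/SphereTangentialLaplacian.lean` (E–S's operator
`∂̃·∂̃` IS the Literature's spherical Laplacian `T = ½ΣᵢΣⱼ ∂²_{L_ij}` on the unit sphere; Euler's
identity for degree-`0` extensions) and the Literature support files
`Literature/Analysis/Calculus/SphereSpectralShell.lean` (`sphDirichlet_eq_neg_sphereIntegral`:
integration by parts along the rotation fields, [folklore]) and
`Literature/Analysis/Calculus/AngularMomentumFields.lean` (`sum_sum_inner_angularField_mul`,
Lagrange's identity); nothing is cited as a fact.  Printed counterpart, NAMED ONLY: M. Lüscher,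
Commun. Math. Phys. 293 (2010) 899, §3 (the operator `𝔏₀ = −Σ ∂·∂` is symmetric and
non-negative with respect to the invariant measure — the basis of the perturbative construction
of the trivializing flow action); Engel–Schaefer, Comput. Phys. Commun. 182 (2011) 2107, §2.2
eq. (12) (the natural derivative `∂̃` as the derivative of the extension `f(x/|x|)`).

## Content (`E` a finite-dimensional real inner product space, `σ = volume.toSphere` Mathlib's
## measure on the unit sphere, `ν y = y/‖y‖`)

* `inner_gradient_eq_fderiv`, `angDeriv_eq_inner_gradient` — `⟪∇f(u), v⟫ = Df(u) v`,
  `∂_{L_ij}f(u) = ⟪L_ij u, ∇f(u)⟫` (bookkeeping).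
* **`half_sum_sum_angDeriv_mul_angDeriv`** — LAGRANGE'S IDENTITY READ FOR THE NATURAL GRADIENTS:
  on the unit sphere, if `Df(u) u = 0` (Euler: `f` a degree-`0` extension) then
  `½ ΣᵢΣⱼ ∂_{L_ij}g(u) ∂_{L_ij}f(u) = ⟪∇g(u), ∇f(u)⟫` — the Literature's Dirichlet integrand is the
  inner product of E–S's natural derivatives.
* **`integral_sphere_mul_laplacian_eq_neg_integral_inner_gradient`** — GREEN'S IDENTITY: for `f`
  of class `C²` and `g` of class `C¹` off the origin with `f ∘ ν = f`,
  `∫ g(u) Δf(u) dσ(u) = −∫ ⟪∇g(u), ∇f(u)⟫ dσ(u)` over the unit sphere (`Δf(u) = ∂̃·∂̃f(u)` there).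
* `integral_sphere_mul_laplacian_comm` — symmetry `∫ g Δf dσ = ∫ f Δg dσ` (both degree-`0`, `C²`);
  `integral_sphere_mul_laplacian_self` — `∫ f Δf dσ = −∫ ‖∇f‖² dσ`, whence
  `integral_sphere_mul_laplacian_self_nonpos`; `integral_sphere_laplacian_eq_zero` — `∫ Δf dσ = 0`.

These are the single-site inputs of the lattice statement (`Exactness/SphereLatticeGreen.lean`):
Lüscher's operator `−Σ_k ∂̃_k·∂̃_k` on the product of site spheres is symmetric and nonnegative.

NOT CLAIMED: the Laplace–Beltrami operator of a manifold library (none is used); spectral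
statements (the Literature's sharp Poincaré inequality is not restated here); anything
quantitative.
-/

noncomputable section

namespace Summit.Ventures.LatticeQCDFlow.Exactness

open NormedSpace Filter Laplacian InnerProductSpace MeasureTheory Metric
open Literature.Analysis.Calculus Literature.Analysis.FluidPDE
open scoped RealInnerProductSpace Topology Gradient

variable {E : Type*} [NormedAddCommGroup E] [InnerProductSpace ℝ E]

/-! ## §1 Lagrange's identity for the natural gradients (pointwise) -/

section Pointwise

variable [CompleteSpace E] {ι : Type*} [Fintype ι]

omit [Fintype ι] in
/-- Bookkeeping: `⟪∇f(u), v⟫ = Df(u) v`. -/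
theorem inner_gradient_eq_fderiv (f : E → ℝ) (u v : E) : ⟪∇ f u, v⟫ = fderiv ℝ f u v := by
  rw [gradient, toDual_symm_apply]

/-- The angular derivative is the gradient paired with the angular field:
`∂_{L_ij} f(u) = ⟪L_ij u, ∇f(u)⟫`. -/
theorem angDeriv_eq_inner_gradient (b : OrthonormalBasis ι ℝ E) (i j : ι) (f : E → ℝ) (u : E) :
    angDeriv b i j f u = ⟪angularField b i j u, ∇ f u⟫ := by
  rw [angDeriv_apply, real_inner_comm, inner_gradient_eq_fderiv]

/-- **Lagrange's identity read for the natural gradients.**  For `‖u‖ = 1` and `Df(u) u = 0`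
(Euler's identity of a degree-`0` extension `f = F ∘ ν`):
`½ ΣᵢΣⱼ ∂_{L_ij}g(u) · ∂_{L_ij}f(u) = ⟪∇g(u), ∇f(u)⟫` — the integrand of the Literature's
spherical Dirichlet form is the inner product of Engel–Schaefer's natural derivatives. -/
theorem half_sum_sum_angDeriv_mul_angDeriv (b : OrthonormalBasis ι ℝ E) {f g : E → ℝ} {u : E}
    (hu : ‖u‖ = 1) (hfu : fderiv ℝ f u u = 0) :
    (1 / 2 : ℝ) * ∑ i, ∑ j, angDeriv b i j g u * angDeriv b i j f u = ⟪∇ g u, ∇ f u⟫ := by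
  simp_rw [angDeriv_eq_inner_gradient]
  rw [sum_sum_inner_angularField_mul b u (∇ g u) (∇ f u), hu, one_pow, one_mul,
    real_inner_comm (∇ f u) u, inner_gradient_eq_fderiv f u u, hfu, mul_zero, sub_zero]
  ring

end Pointwise

/-! ## §2 Green's identity on the unit sphere -/

section Green

variable [FiniteDimensional ℝ E] [MeasurableSpace E] [BorelSpace E]

omit [FiniteDimensional ℝ E] [MeasurableSpace E] [BorelSpace E] in
/-- A degree-`0` extension has no radial derivative: if `f ∘ ν = f` then `Df(y) y = 0` for `y ≠ 0`
at which `f` is differentiable (at `ν y`). -/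
theorem fderiv_apply_self_eq_zero_of_comp_normalize {f : E → ℝ} (hf0 : ∀ y, f (normalize y) = f y)
    {y : E} (hy : y ≠ 0) (hf : DifferentiableAt ℝ f (normalize y)) : fderiv ℝ f y y = 0 := by
  have h := fderiv_comp_normalize_apply_self hy hf
  have hfun : (fun z => f (normalize z)) = f := funext hf0
  rwa [hfun] at h

omit [MeasurableSpace E] [BorelSpace E] in
/-- On the unit sphere, the flat Laplacian of a degree-`0` extension is the spherical Laplacian:
`Δf(u) = T f(u)` for `‖u‖ = 1`, `f ∘ ν = f`, `f ∈ C²` at `u`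
(`SphereTangentialLaplacian.laplacian_comp_normalize_eq_sphLaplacian`). -/
theorem laplacian_eq_sphLaplacian_of_comp_normalize {ι : Type*} [Fintype ι]
    (b : OrthonormalBasis ι ℝ E) {f : E → ℝ} (hf0 : ∀ y, f (normalize y) = f y) {u : E}
    (hu : ‖u‖ = 1) (hf : ContDiffAt ℝ 2 f u) : Δ f u = sphLaplacian b f u := by
  have hfun : (fun z => f (normalize z)) = f := funext hf0
  have h := laplacian_comp_normalize_eq_sphLaplacian b hu hf
  rwa [hfun] at h

/-- The sphere integral at radius `1` is the integral over Mathlib's sphere measure. -/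
theorem sphereIntegral_one_eq_integral (F : E → ℝ) :
    sphereIntegral (volume : Measure E) F 1 =
      ∫ u : sphere (0 : E) 1, F u ∂(volume : Measure E).toSphere := by
  rw [sphereIntegral_def]
  simp only [one_smul]

/-- **Green's identity for Engel–Schaefer's natural operators on one site sphere.**  For `f` of
class `C²` and `g` of class `C¹` off the origin, `f` a degree-`0` extension (`f ∘ ν = f`, so that
`Δf = ∂̃·∂̃f` on the unit sphere and `∇f = ∂̃f` is tangential), and `dim E ≥ 1`:
`∫ g(u) Δf(u) dσ(u) = −∫ ⟪∇g(u), ∇f(u)⟫ dσ(u)`, `σ = volume.toSphere`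
(integration by parts along the rotation fields `L_ij`, then Lagrange's identity). -/
theorem integral_sphere_mul_laplacian_eq_neg_integral_inner_gradient [Nontrivial E] {f g : E → ℝ}
    (hf : ContDiffOn ℝ 2 f {0}ᶜ) (hf0 : ∀ y, f (normalize y) = f y) (hg : ContDiffOn ℝ 1 g {0}ᶜ) :
    ∫ u : sphere (0 : E) 1, g u * Δ f u ∂(volume : Measure E).toSphere =
      -∫ u : sphere (0 : E) 1, ⟪∇ g u, ∇ f u⟫ ∂(volume : Measure E).toSphere := by
  set b := stdOrthonormalBasis ℝ E
  have hO : IsOpen ({0}ᶜ : Set E) := isOpen_compl_singleton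
  have hmem : ∀ {x : E}, ‖x‖ = 1 → x ∈ ({0}ᶜ : Set E) := fun hx =>
    mem_compl_zero_of_norm_eq one_pos hx
  have hf1 : ContDiffOn ℝ 1 f {0}ᶜ := hf.of_le (by norm_num)
  -- (1) `Δf = T f` on the unit sphere
  have hΔ : ∀ x : E, ‖x‖ = 1 → g x * Δ f x = g x * sphLaplacian b f x := by
    intro x hx
    rw [laplacian_eq_sphLaplacian_of_comp_normalize b hf0 hx (hf.contDiffAt (hO.mem_nhds (hmem hx)))]
  -- (2) the Literature's integration by parts: `Q₁(g, f) = −∮ g · T f`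
  have hIBP := sphDirichlet_eq_neg_sphereIntegral b hg hf one_pos
  -- (3) `Q₁(g, f) = ∮ ⟪∇g, ∇f⟫`
  have hcont : ∀ i j, ContinuousOn (fun x => angDeriv b i j g x * angDeriv b i j f x) {0}ᶜ :=
    fun i j => (continuousOn_angDeriv b i j hg le_rfl).mul (continuousOn_angDeriv b i j hf1 le_rfl)
  have hQ : sphDirichlet b g f 1 =
      sphereIntegral (volume : Measure E) (fun x => ⟪∇ g x, ∇ f x⟫) 1 := by
    calc sphDirichlet b g f 1
        = (1 / 2 : ℝ) * ∑ i, sphereIntegral (volume : Measure E)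
            (fun x => ∑ j, angDeriv b i j g x * angDeriv b i j f x) 1 := by
          unfold sphDirichlet
          congr 1
          refine Finset.sum_congr rfl fun i _ => ?_
          exact (sphereIntegral_finset_sum _ (fun j _ => hcont i j) one_pos).symm
      _ = (1 / 2 : ℝ) * sphereIntegral (volume : Measure E)
            (fun x => ∑ i, ∑ j, angDeriv b i j g x * angDeriv b i j f x) 1 := by
          rw [sphereIntegral_finset_sum _
            (fun i _ => continuousOn_finsetSum _ fun j _ => hcont i j) one_pos]
      _ = sphereIntegral (volume : Measure E)
            (fun x => (1 / 2 : ℝ) * ∑ i, ∑ j, angDeriv b i j g x * angDeriv b i j f x) 1 :=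
          (sphereIntegral_mul_left _ _ _).symm
      _ = sphereIntegral (volume : Measure E) (fun x => ⟪∇ g x, ∇ f x⟫) 1 := by
          refine sphereIntegral_congr_norm zero_le_one fun x hx => ?_
          have hx0 : x ≠ 0 := by rintro rfl; simp at hx
          have hfd : DifferentiableAt ℝ f (normalize x) := by
            rw [normalize_eq_self_of_norm_eq_one hx]
            exact (hf1.differentiableOn one_ne_zero).differentiableAt (hO.mem_nhds (hmem hx))
          exact half_sum_sum_angDeriv_mul_angDeriv b hx
            (fderiv_apply_self_eq_zero_of_comp_normalize hf0 hx0 hfd)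
  have e1 := sphereIntegral_one_eq_integral (fun x => g x * Δ f x)
  have e2 := sphereIntegral_one_eq_integral (fun x => ⟪∇ g x, ∇ f x⟫)
  rw [← e1, ← e2, sphereIntegral_congr_norm zero_le_one hΔ, ← hQ, hIBP, neg_neg]

/-- **Symmetry of `∂̃·∂̃` on one site sphere**: `∫ g Δf dσ = ∫ f Δg dσ` for degree-`0` extensions
`f`, `g` of class `C²` off the origin. -/
theorem integral_sphere_mul_laplacian_comm [Nontrivial E] {f g : E → ℝ}
    (hf : ContDiffOn ℝ 2 f {0}ᶜ) (hf0 : ∀ y, f (normalize y) = f y)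
    (hg : ContDiffOn ℝ 2 g {0}ᶜ) (hg0 : ∀ y, g (normalize y) = g y) :
    ∫ u : sphere (0 : E) 1, g u * Δ f u ∂(volume : Measure E).toSphere =
      ∫ u : sphere (0 : E) 1, f u * Δ g u ∂(volume : Measure E).toSphere := by
  rw [integral_sphere_mul_laplacian_eq_neg_integral_inner_gradient hf hf0 (hg.of_le (by norm_num)),
    integral_sphere_mul_laplacian_eq_neg_integral_inner_gradient hg hg0 (hf.of_le (by norm_num))]
  simp_rw [real_inner_comm (∇ f _)]

/-- **The energy identity**: `∫ f Δf dσ = −∫ ‖∇f‖² dσ` for a degree-`0` extension `f` of class `C²`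
off the origin. -/
theorem integral_sphere_mul_laplacian_self [Nontrivial E] {f : E → ℝ}
    (hf : ContDiffOn ℝ 2 f {0}ᶜ) (hf0 : ∀ y, f (normalize y) = f y) :
    ∫ u : sphere (0 : E) 1, f u * Δ f u ∂(volume : Measure E).toSphere =
      -∫ u : sphere (0 : E) 1, ‖∇ f u‖ ^ 2 ∂(volume : Measure E).toSphere := by
  rw [integral_sphere_mul_laplacian_eq_neg_integral_inner_gradient hf hf0 (hf.of_le (by norm_num))]
  simp_rw [real_inner_self_eq_norm_sq]

/-- **Non-positivity of `∂̃·∂̃`** on one site sphere: `∫ f Δf dσ ≤ 0`. -/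
theorem integral_sphere_mul_laplacian_self_nonpos [Nontrivial E] {f : E → ℝ}
    (hf : ContDiffOn ℝ 2 f {0}ᶜ) (hf0 : ∀ y, f (normalize y) = f y) :
    ∫ u : sphere (0 : E) 1, f u * Δ f u ∂(volume : Measure E).toSphere ≤ 0 := by
  rw [integral_sphere_mul_laplacian_self hf hf0, neg_nonpos]
  exact integral_nonneg fun u => sq_nonneg _

/-- **`∫ Δf dσ = 0`**: the spherical Laplacian of a degree-`0` extension integrates to zero over the
unit sphere (Green's identity with `g = 1`). -/
theorem integral_sphere_laplacian_eq_zero [Nontrivial E] {f : E → ℝ}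
    (hf : ContDiffOn ℝ 2 f {0}ᶜ) (hf0 : ∀ y, f (normalize y) = f y) :
    ∫ u : sphere (0 : E) 1, Δ f u ∂(volume : Measure E).toSphere = 0 := by
  have h := integral_sphere_mul_laplacian_eq_neg_integral_inner_gradient hf hf0
    (g := fun _ => (1 : ℝ)) contDiffOn_const
  have h0 : ∀ u : E, ∇ (fun _ : E => (1 : ℝ)) u = 0 := fun u => by
    rw [gradient, fderiv_const_apply, map_zero]
  simpa [h0] using h

end Green

end Summit.Ventures.LatticeQCDFlow.Exactness

end
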